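import Mathlib
import Literature.MathematicalPhysics.QuantumFieldTheory.Balaban1983to89.B10LargeField

/-!
# `Summit.QuantumFields.Balaban3D.Proofs.CouplingWindow` — lane «pub-balaban3d» (Bałaban, CMP **102** (1985) 255–275, d = 3
# lattice UV stability AS PRINTED), prover seat p2: the coupling arithmetic behind «for g_{k−1} sufficiently small»
# (p. 267 L9, (45)) and «for g_j sufficiently small» (p. 273 L27, (71)) along the printed flow `g_k = g(L^kε)^{1/2}`

HONEST FRAMING (lane PLAN.md §0).  Nothing of [B10] = [Balaban1985UV3] is asserted here.  This is E2 ARITHMETIC (lane ladder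
§0.5) shared by the seat's leaf files `…Proofs.Thresholds` → `…Proofs.Bound46Series` → `…Proofs.Bound46Std` ((46) ⇒ `LeafSystem.bound46` via `Thresholds.gammaOf_spec`; the leaf form `bound46_leaf` over `B10Eq44SpecialUnitary.bound46_specialUnitary` is HOME drafts/p2/Bound46Knit.lean :104, a documentation draft, not in the tree) and `…Proofs.PerPlaquette71`
((67)–(71) per plaquette): every smallness premise of the 4D cell's concrete theorems
(`B10Eq44SpecialUnitary.bound46_specialUnitary`, `B10Eq71Concrete.smallFactor_specialUnitary`) is of the form
«(polynomial in `x(g) = 1 + log g⁻¹`) × g ≤ constant» at `g = g_{k−1}` or `g = g_j`, and the tangent-line lemma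
`B10.rpow_mul_exp_neg_le` of the 4D cell turns each into ONE threshold `g ≤ γ` — the lane's reading of p. 256 L16–17
«ε₀ is a positive constant depending on the coupling constant g only» (along a run `g_k ≤ gε₀^{1/2}`).

CONTENT (all [folklore]-level real analysis or one-line consequences of the printed definitions (5) p. 256, (7) p. 257;
journal page = PDF page + 254):
* §1 `pFun_pos`, `pFun_antitone` (p(g) = b₀(1 + log g⁻¹)^{p₀} decreases in g), `gp_le_sqrt` (g·p(g) ≤ b₀(2p₀)^{p₀}e^{½−p₀}√g),
  `gpx_le_sqrt` (g·p(g)·x(g)^{r₀} ≤ b₀(2(p₀+r₀))^{p₀+r₀}e^{½−p₀−r₀}√g — the radius `R(g) = R₁x(g)^{r₀}` of (39) absorbed),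
  `gp_le_of_le_gamma` (ONE threshold);
* §2 the flow `g_i = g(L^iε)^{1/2}` (`B10.gRun`): `gRun_sq`, `gRun_sq_scale` (g_k² = g_j²L^{k−j}), `gRun_le_of_le` (monotone),
  `gRun_pred_scale_sq_le` (g_{k−1}(L^jη)² ≤ g_j for j < k);
* §3 scales against logarithms: `xpow_exp_le` ((x + u)^{r₀}e^{−4u} ≤ (r₀/4)^{r₀}e^{4−r₀}·x^{r₀} for x ≥ 1, u ≥ 0),
  `scale_sq_eq_exp` ((L^jη)² = e^{−4(k−j)·½log L}), `radius_scale_le` ((R₁M₁x(g_j)^{r₀} + 1)(L^jη)² ≤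
  R₁M₁(r₀/4)^{r₀}e^{4−r₀}x(g_k)^{r₀} + 1 along the flow — the admissibility radius «|c_{i,−} − y| < R(g_j)M₁L^jη» of (43)
  against the factor (L^jη)² of (44));
* §4 `hD_of_threshold` — the radius premise `hD` of `B10Eq44SpecialUnitary.bound46_specialUnitary` / of the leaf form `bound46_leaf` (HOME drafts/p2/Bound46Knit.lean :104, a documentation draft, not in the tree) («D·4L²B₃g_{k−1}p(g_{k−1})(L^jη)² ≤ ½») from the
  printed radii `D ≤ R₁M₁x(g_j)^{r₀} + 1` and ONE threshold `√g_{k−1} ≤ τ`.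
-/

noncomputable section

namespace Summit.QuantumFields.Balaban3D.Proofs.CouplingWindow

open Literature.MathematicalPhysics.QuantumFieldTheory.Balaban1983to89
open B10LargeField (xlog pFun_eq one_le_xlog xlog_gRun)

/-! ## §1 The window function `p(g)` against powers of `g` -/

section PFun

/-- `0 < p(g)` for `b₀ > 0`, `0 < g ≤ 1` ((7) p. 257: p(g) = b₀(1 + log g⁻¹)^{p₀}). [cite: Balaban1985UV3, (7) p.257] -/
theorem pFun_pos (b₀ p₀ g : ℝ) (hb : 0 < b₀) (hg : 0 < g) (hg1 : g ≤ 1) : 0 < B10.pFun b₀ p₀ g := by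
  unfold B10.pFun
  have hu := B10.log_inv_nonneg_of_le_one hg hg1
  exact mul_pos hb (Real.rpow_pos_of_pos (by linarith) _)

/-- `p(g)` is ANTITONE in `g` on (0, 1] for `b₀, p₀ ≥ 0`. [cite: Balaban1985UV3, (7) p.257] -/
theorem pFun_antitone {b₀ p₀ g g' : ℝ} (hb : 0 ≤ b₀) (hp : 0 ≤ p₀) (hg : 0 < g) (hgg' : g ≤ g') (hg'1 : g' ≤ 1) :
    B10.pFun b₀ p₀ g' ≤ B10.pFun b₀ p₀ g := by
  unfold B10.pFun
  have hg' : 0 < g' := lt_of_lt_of_le hg hgg'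
  have hu' := B10.log_inv_nonneg_of_le_one hg' hg'1
  have hlog : Real.log g'⁻¹ ≤ Real.log g⁻¹ := Real.log_le_log (inv_pos.mpr hg') (inv_anti₀ hg hgg')
  exact mul_le_mul_of_nonneg_left (Real.rpow_le_rpow (by linarith) (by linarith) hp) hb

/-- `g·p(g) ≤ b₀(2p₀)^{p₀}e^{½−p₀}·√g` on (0, 1] (`b₀ ≥ 0`, `p₀ > 0`): the tangent-line bound `B10.rpow_mul_exp_neg_le` with
`c = ½` — half of the decay `g = e^{−log g⁻¹}` pays for the logarithmic growth of `p(g)`. [cite: Balaban1985UV3, (7) p.257] -/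
theorem gp_le_sqrt (b₀ p₀ g : ℝ) (hb : 0 ≤ b₀) (hp : 0 < p₀) (hg : 0 < g) (hg1 : g ≤ 1) :
    g * B10.pFun b₀ p₀ g ≤ b₀ * ((2 * p₀) ^ p₀ * Real.exp (1 / 2 - p₀)) * Real.sqrt g := by
  have hu := B10.log_inv_nonneg_of_le_one hg hg1
  set u := Real.log g⁻¹ with hu_def
  have hcore := B10.rpow_mul_exp_neg_le p₀ (1 / 2) u hp (by norm_num) (by linarith)
  rw [show p₀ / (1 / 2) = 2 * p₀ by ring] at hcore
  have hg_exp : g = Real.exp (-u) := by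
    rw [hu_def, Real.log_inv, neg_neg, Real.exp_log hg]
  have hsqrt : Real.sqrt g = Real.exp (-(1 / 2 * u)) := by
    rw [hg_exp, ← Real.exp_half]
    congr 1
    ring
  have hsplit : Real.exp (-u) = Real.exp (-(1 / 2 * u)) * Real.exp (-(1 / 2 * u)) := by
    rw [← Real.exp_add]
    congr 1
    ring
  have hK : 0 ≤ b₀ * Real.exp (-(1 / 2 * u)) := mul_nonneg hb (Real.exp_pos _).le
  calc g * B10.pFun b₀ p₀ g
      = (b₀ * Real.exp (-(1 / 2 * u))) * ((1 + u) ^ p₀ * Real.exp (-(1 / 2 * u))) := by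
        unfold B10.pFun
        rw [← hu_def, hg_exp, hsplit]
        ring
    _ ≤ (b₀ * Real.exp (-(1 / 2 * u))) * ((2 * p₀) ^ p₀ * Real.exp (1 / 2 - p₀)) :=
        mul_le_mul_of_nonneg_left hcore hK
    _ = b₀ * ((2 * p₀) ^ p₀ * Real.exp (1 / 2 - p₀)) * Real.sqrt g := by
        rw [hsqrt]
        ring

/-- `g·p(g)·x(g)^{r₀} ≤ b₀(2(p₀+r₀))^{p₀+r₀}e^{½−(p₀+r₀)}·√g` on (0, 1] (`b₀, r₀ ≥ 0`, `p₀ + r₀ > 0`): the radius factor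
`r(g) = x(g)^{r₀}` of (7)/(39) (`R(g) = R₁r(g)`) is absorbed the same way (`p(g)x(g)^{r₀} = b₀x(g)^{p₀+r₀}`). [cite: Balaban1985UV3, (7) p.257, (39) p.266] -/
theorem gpx_le_sqrt (b₀ p₀ r₀ g : ℝ) (hb : 0 ≤ b₀) (hpr : 0 < p₀ + r₀) (hg : 0 < g) (hg1 : g ≤ 1) :
    g * B10.pFun b₀ p₀ g * xlog g ^ r₀ ≤
      b₀ * ((2 * (p₀ + r₀)) ^ (p₀ + r₀) * Real.exp (1 / 2 - (p₀ + r₀))) * Real.sqrt g := by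
  have hx : 1 ≤ xlog g := one_le_xlog hg hg1
  have hid : g * B10.pFun b₀ p₀ g * xlog g ^ r₀ = g * B10.pFun b₀ (p₀ + r₀) g := by
    rw [pFun_eq, pFun_eq, Real.rpow_add (by linarith)]
    ring
  rw [hid]
  exact gp_le_sqrt b₀ (p₀ + r₀) g hb hpr hg hg1

/-- ONE THRESHOLD: if `0 < g ≤ γ ≤ 1` with `γ ≤ (σ/(b₀(2p₀)^{p₀}e^{½−p₀}))²` (`b₀, p₀ > 0`, `σ ≥ 0`), then `g·p(g) ≤ σ`.  This is
how the lane reads «for g_{k−1} sufficiently small» (p. 267 L9) and «for g_j sufficiently small» (p. 273 L27): along a run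
`g_{k−1} ≤ gε₀^{1/2}` (p. 256), so each threshold is a condition «ε₀ sufficiently small depending on g» (p. 256 L16–17).
[cite: Balaban1985UV3, p.256 + p.267 + p.273] -/
theorem gp_le_of_le_gamma (b₀ p₀ σ γ g : ℝ) (hb : 0 < b₀) (hp : 0 < p₀) (hσ : 0 ≤ σ)
    (hγ : γ ≤ (σ / (b₀ * ((2 * p₀) ^ p₀ * Real.exp (1 / 2 - p₀)))) ^ 2) (hγ1 : γ ≤ 1)
    (hg : 0 < g) (hgγ : g ≤ γ) : g * B10.pFun b₀ p₀ g ≤ σ := by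
  set K := b₀ * ((2 * p₀) ^ p₀ * Real.exp (1 / 2 - p₀)) with hK_def
  have hK : 0 < K := by positivity
  have h1 := gp_le_sqrt b₀ p₀ g hb.le hp hg (hgγ.trans hγ1)
  have hsq : Real.sqrt g ≤ σ / K := by
    have hσK : 0 ≤ σ / K := div_nonneg hσ hK.le
    calc Real.sqrt g ≤ Real.sqrt ((σ / K) ^ 2) := Real.sqrt_le_sqrt (hgγ.trans hγ)
      _ = σ / K := Real.sqrt_sq hσK
  calc g * B10.pFun b₀ p₀ g ≤ K * Real.sqrt g := h1
    _ ≤ K * (σ / K) := mul_le_mul_of_nonneg_left hsq hK.le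
    _ = σ := by field_simp

end PFun

/-! ## §2 The printed flow `g_i = g(L^iε)^{1/2}` (p. 256) -/

section Flow

/-- `g_i² = g²·L^iε` (p. 256 [2]: «g_k² = g²L^kε»). [cite: Balaban1985UV3, (5) p.256] -/
theorem gRun_sq (gb L ε : ℝ) (hL : 0 ≤ L) (hε : 0 ≤ ε) (i : ℕ) :
    B10.gRun gb L ε i ^ 2 = gb ^ 2 * (L ^ i * ε) := by
  unfold B10.gRun
  rw [mul_pow, Real.sq_sqrt (by positivity)]

/-- `g_k² = g_j²L^{k−j}` for `j ≤ k` (p. 273 L25: the rescaling `1/g_k² = L^{−(k−j)}/g_j²` behind (71)). [cite: Balaban1985UV3, (71) p.273] -/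
theorem gRun_sq_scale (gb L ε : ℝ) (hL : 0 ≤ L) (hε : 0 ≤ ε) {j k : ℕ} (hjk : j ≤ k) :
    B10.gRun gb L ε k ^ 2 = B10.gRun gb L ε j ^ 2 * L ^ (k - j) := by
  rw [gRun_sq gb L ε hL hε, gRun_sq gb L ε hL hε]
  conv_lhs => rw [← Nat.add_sub_cancel' hjk, pow_add]
  ring

/-- The couplings GROW along the flow: `g_j ≤ g_i` for `j ≤ i`, `L ≥ 1` (d = 3, p. 256; no asymptotic freedom bookkeeping).
[cite: Balaban1985UV3, (5) p.256] -/
theorem gRun_le_of_le (gb L ε : ℝ) (hg : 0 ≤ gb) (hL : 1 ≤ L) (hε : 0 ≤ ε) {j i : ℕ} (hji : j ≤ i) :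
    B10.gRun gb L ε j ≤ B10.gRun gb L ε i := by
  unfold B10.gRun
  refine mul_le_mul_of_nonneg_left (Real.sqrt_le_sqrt ?_) hg
  exact mul_le_mul_of_nonneg_right (pow_le_pow_right₀ hL hji) hε

/-- `g_{k−1}·(L^jη)² ≤ g_j` for `j < k` (`η = L^{−k}`): the factor `(L^jη)² = L^{−2(k−j)}` beats the growth
`g_{k−1}/g_j = L^{(k−1−j)/2}` — why the step-`k` regularity (44) p. 267 implies (68) p. 273 at every earlier scale. [cite: Balaban1985UV3, (44) p.267, (68) p.273] -/
theorem gRun_pred_scale_sq_le (gb L ε : ℝ) (hg : 0 ≤ gb) (hL : 1 ≤ L) (hε : 0 ≤ ε) {j k : ℕ} (hjk : j < k) :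
    B10.gRun gb L ε (k - 1) * (L ^ j * (L ^ k)⁻¹) ^ 2 ≤ B10.gRun gb L ε j := by
  unfold B10.gRun
  have hL0 : 0 < L := by linarith
  have hsc : 0 ≤ (L ^ j * (L ^ k)⁻¹) ^ 2 := sq_nonneg _
  have h1 : Real.sqrt (L ^ (k - 1) * ε) * (L ^ j * (L ^ k)⁻¹) ^ 2
      = Real.sqrt (L ^ (k - 1) * ε * ((L ^ j * (L ^ k)⁻¹) ^ 2) ^ 2) := by
    conv_rhs => rw [Real.sqrt_mul' _ (sq_nonneg _), Real.sqrt_sq hsc]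
  have h2 : L ^ (k - 1) * ε * ((L ^ j * (L ^ k)⁻¹) ^ 2) ^ 2 ≤ L ^ j * ε := by
    have hpow : L ^ (k - 1) * (L ^ j) ^ 4 ≤ L ^ j * (L ^ k) ^ 4 := by
      rw [← pow_mul, ← pow_mul, ← pow_add, ← pow_add]
      exact pow_le_pow_right₀ hL (by omega)
    have hid : ((L ^ j * (L ^ k)⁻¹) ^ 2) ^ 2 = (L ^ j) ^ 4 * ((L ^ k) ^ 4)⁻¹ := by
      rw [← inv_pow]; ring
    rw [hid]
    calc L ^ (k - 1) * ε * ((L ^ j) ^ 4 * ((L ^ k) ^ 4)⁻¹)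
        = (L ^ (k - 1) * (L ^ j) ^ 4) * ((L ^ k) ^ 4)⁻¹ * ε := by ring
      _ ≤ (L ^ j * (L ^ k) ^ 4) * ((L ^ k) ^ 4)⁻¹ * ε :=
          mul_le_mul_of_nonneg_right (mul_le_mul_of_nonneg_right hpow (by positivity)) hε
      _ = L ^ j * ε := by field_simp
  calc gb * Real.sqrt (L ^ (k - 1) * ε) * (L ^ j * (L ^ k)⁻¹) ^ 2
      = gb * (Real.sqrt (L ^ (k - 1) * ε) * (L ^ j * (L ^ k)⁻¹) ^ 2) := by ring
    _ ≤ gb * Real.sqrt (L ^ j * ε) := by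
        refine mul_le_mul_of_nonneg_left ?_ hg
        rw [h1]
        exact Real.sqrt_le_sqrt h2

end Flow

/-! ## §3 Scales against logarithms: `(L^jη)²` beats `R(g_j)` -/

section Radius

/-- `(x + u)^{r₀}·e^{−4u} ≤ (r₀/4)^{r₀}e^{4−r₀}·x^{r₀}` for `x ≥ 1`, `u ≥ 0`, `r₀ ≥ 0`: a polynomial in the logarithmic unit grows
slower than the scale factor decays (`B10.rpow_mul_exp_neg_le` with `c = 4`; for `r₀ = 0` the constant is `e⁴ ≥ 1`). [folklore] -/
theorem xpow_exp_le (x u r₀ : ℝ) (hx : 1 ≤ x) (hu : 0 ≤ u) (hr : 0 ≤ r₀) :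
    (x + u) ^ r₀ * Real.exp (-(4 * u)) ≤ ((r₀ / 4) ^ r₀ * Real.exp (4 - r₀)) * x ^ r₀ := by
  have hx0 : 0 < x := by linarith
  have hxr : 0 ≤ x ^ r₀ := Real.rpow_nonneg hx0.le _
  -- (x + u)^{r₀} = x^{r₀}(1 + u/x)^{r₀} ≤ x^{r₀}(1 + u)^{r₀}
  have hsplit : (x + u) ^ r₀ = x ^ r₀ * (1 + u / x) ^ r₀ := by
    rw [← Real.mul_rpow hx0.le (by positivity)]
    congr 1
    field_simp
  have hmono : (1 + u / x) ^ r₀ ≤ (1 + u) ^ r₀ := by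
    refine Real.rpow_le_rpow (by positivity) ?_ hr
    have : u / x ≤ u := div_le_self hu hx
    linarith
  rcases eq_or_lt_of_le hr with hr0 | hr0
  · -- r₀ = 0
    rw [← hr0]
    simp only [Real.rpow_zero, one_mul, mul_one, sub_zero]
    have h4 : Real.exp (-(4 * u)) ≤ 1 := by
      rw [Real.exp_le_one_iff]; linarith
    have he : (1 : ℝ) ≤ Real.exp 4 := Real.one_le_exp (by norm_num)
    linarith
  · have hcore := B10.rpow_mul_exp_neg_le r₀ 4 u hr0 (by norm_num) (by linarith)
    calc (x + u) ^ r₀ * Real.exp (-(4 * u))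
        = x ^ r₀ * ((1 + u / x) ^ r₀ * Real.exp (-(4 * u))) := by rw [hsplit]; ring
      _ ≤ x ^ r₀ * ((1 + u) ^ r₀ * Real.exp (-(4 * u))) :=
          mul_le_mul_of_nonneg_left (mul_le_mul_of_nonneg_right hmono (Real.exp_pos _).le) hxr
      _ ≤ x ^ r₀ * ((r₀ / 4) ^ r₀ * Real.exp (4 - r₀)) := mul_le_mul_of_nonneg_left hcore hxr
      _ = ((r₀ / 4) ^ r₀ * Real.exp (4 - r₀)) * x ^ r₀ := by ring

/-- `(L^jη)² = (L^j(L^k)⁻¹)² = e^{−4(k−j)·½log L}` for `j ≤ k`, `L > 0` — the scale factor of (44) in the logarithmic unit of the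
flow (`x(g_j) = x(g_k) + (k − j)·½log L`, `B10LargeField.xlog_gRun`). [folklore] -/
theorem scale_sq_eq_exp (L : ℝ) (hL : 0 < L) {j k : ℕ} (hjk : j ≤ k) :
    (L ^ j * (L ^ k)⁻¹) ^ 2 = Real.exp (-(4 * (((k - j : ℕ) : ℝ) * (Real.log L / 2)))) := by
  have hLj : 0 < L ^ j := pow_pos hL j
  have hid : L ^ j * (L ^ k)⁻¹ = (L ^ (k - j))⁻¹ := by
    conv_lhs => rw [← Nat.add_sub_cancel' hjk, pow_add]
    field_simp
  rw [hid, inv_pow, ← Real.exp_log (pow_pos (pow_pos hL _) 2), ← Real.exp_neg]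
  congr 1
  rw [Real.log_pow, Real.log_pow]
  push_cast
  ring

/-- **The admissibility radius of (43) against the scale factor of (44):** along the flow `g_i = g(L^iε)^{1/2}` and for
`j ≤ k`, `(R₁M₁·x(g_j)^{r₀} + 1)·(L^jη)² ≤ R₁M₁(r₀/4)^{r₀}e^{4−r₀}·x(g_{k−1})^{r₀} + 1` (`R₁M₁, r₀ ≥ 0`, all `g_i ∈ (0, 1]`):
the radius `R(g_j)M₁ = R₁x(g_j)^{r₀}M₁` («|c_{i,−} − y| < R(g_j)M₁L^jη», (43) p. 266) grows only polynomially in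
`x(g_j) = x(g_k) + (k − j)½log L` while `(L^jη)²` decays exponentially, and `x(g_k) ≤ x(g_{k−1})`. [cite: Balaban1985UV3, (43) p.266, (44) p.267] -/
theorem radius_scale_le (gb L ε R₁M₁ r₀ : ℝ) (hg : 0 < gb) (hL : 1 < L) (hε : 0 < ε) (hRM : 0 ≤ R₁M₁) (hr : 0 ≤ r₀)
    {j k : ℕ} (hjk : j ≤ k) (hgk : B10.gRun gb L ε k ≤ 1) :
    (R₁M₁ * xlog (B10.gRun gb L ε j) ^ r₀ + 1) * (L ^ j * (L ^ k)⁻¹) ^ 2 ≤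
      R₁M₁ * ((r₀ / 4) ^ r₀ * Real.exp (4 - r₀)) * xlog (B10.gRun gb L ε (k - 1)) ^ r₀ + 1 := by
  have hL0 : 0 < L := by linarith
  have hℓ0 : 0 ≤ Real.log L / 2 := by have := Real.log_nonneg hL.le; linarith
  set xk : ℝ := xlog (B10.gRun gb L ε k) with hxk_def
  set u : ℝ := ((k - j : ℕ) : ℝ) * (Real.log L / 2) with hu_def
  have hu : 0 ≤ u := by positivity
  have hgkpos : 0 < B10.gRun gb L ε k := B10.gRun_pos gb L ε hg hL0 hε k
  have hxk1 : 1 ≤ xk := one_le_xlog hgkpos hgk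
  -- x(g_j) = x(g_k) + (k − j)ℓ₀ and (L^jη)² = e^{−4(k−j)ℓ₀}
  have hxj : xlog (B10.gRun gb L ε j) = xk + u := xlog_gRun gb L ε hg hL0 hε hjk
  have hsc : (L ^ j * (L ^ k)⁻¹) ^ 2 = Real.exp (-(4 * u)) := scale_sq_eq_exp L hL0 hjk
  have hsc1 : (L ^ j * (L ^ k)⁻¹) ^ 2 ≤ 1 := by
    rw [hsc, Real.exp_le_one_iff]; linarith
  have hsc0 : 0 ≤ (L ^ j * (L ^ k)⁻¹) ^ 2 := sq_nonneg _
  have hmain : xlog (B10.gRun gb L ε j) ^ r₀ * (L ^ j * (L ^ k)⁻¹) ^ 2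
      ≤ ((r₀ / 4) ^ r₀ * Real.exp (4 - r₀)) * xk ^ r₀ := by
    rw [hxj, hsc]
    exact xpow_exp_le xk u r₀ hxk1 hu hr
  -- x(g_k) ≤ x(g_{k−1}) (the coupling grows, the unit decreases)
  have hxmono : xk ^ r₀ ≤ xlog (B10.gRun gb L ε (k - 1)) ^ r₀ := by
    have hgk1 : B10.gRun gb L ε (k - 1) ≤ B10.gRun gb L ε k := gRun_le_of_le gb L ε hg.le hL.le hε.le (by omega)
    have hgk1pos : 0 < B10.gRun gb L ε (k - 1) := B10.gRun_pos gb L ε hg hL0 hε (k - 1)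
    have hxle : xk ≤ xlog (B10.gRun gb L ε (k - 1)) := by
      rw [hxk_def]
      unfold xlog
      have := Real.log_le_log (inv_pos.mpr hgkpos) (inv_anti₀ hgk1pos hgk1)
      linarith
    exact Real.rpow_le_rpow (by linarith) hxle hr
  have hK : 0 ≤ R₁M₁ * ((r₀ / 4) ^ r₀ * Real.exp (4 - r₀)) := by positivity
  calc (R₁M₁ * xlog (B10.gRun gb L ε j) ^ r₀ + 1) * (L ^ j * (L ^ k)⁻¹) ^ 2
      = R₁M₁ * (xlog (B10.gRun gb L ε j) ^ r₀ * (L ^ j * (L ^ k)⁻¹) ^ 2) + (L ^ j * (L ^ k)⁻¹) ^ 2 := by ring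
    _ ≤ R₁M₁ * (((r₀ / 4) ^ r₀ * Real.exp (4 - r₀)) * xk ^ r₀) + 1 :=
        add_le_add (mul_le_mul_of_nonneg_left hmain hRM) hsc1
    _ = R₁M₁ * ((r₀ / 4) ^ r₀ * Real.exp (4 - r₀)) * xk ^ r₀ + 1 := by ring
    _ ≤ R₁M₁ * ((r₀ / 4) ^ r₀ * Real.exp (4 - r₀)) * xlog (B10.gRun gb L ε (k - 1)) ^ r₀ + 1 := by
        have := mul_le_mul_of_nonneg_left hxmono hK
        linarith

end Radius

/-! ## §4 The admissibility-radius premise `hD` of `B10Eq44SpecialUnitary.bound46_specialUnitary` (leaf form `bound46_leaf`: HOME drafts/p2/Bound46Knit.lean :104, a documentation draft, not in the tree) from one threshold -/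

section RadiusHD

/-- **The admissibility-radius smallness `hD` of `B10Eq44SpecialUnitary.bound46_specialUnitary` (leaf form `bound46_leaf`, HOME drafts/p2/Bound46Knit.lean :104, a documentation draft, not in the tree) from ONE threshold.**  If the radii are the printed ones,
`D k j ≤ R₁M₁·x(g_j)^{r₀} + 1` («|c_{i,−} − y| < R(g_j)M₁L^jη», (43) p. 266; `R(g) = R₁(1 + log g⁻¹)^{r₀}`, (7) p. 257 / (39)
p. 266; `+1` for the integer ceiling), the couplings follow the printed flow `g_i = g(L^iε)^{1/2}` with `g_k ≤ 1`, and
`√g_{k−1} ≤ τ` with `4L²B₃b₀(R₁M₁·(r₀/4)^{r₀}e^{4−r₀}·(2(p₀+r₀))^{p₀+r₀}e^{½−p₀−r₀} + (2p₀)^{p₀}e^{½−p₀})·τ ≤ ½`, then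
`D·4L²B₃g_{k−1}p(g_{k−1})(L^jη)² ≤ ½` for every `1 ≤ j ≤ k` (`CouplingWindow.radius_scale_le` + `gpx_le_sqrt` + `gp_le_sqrt`).
E2 arithmetic; no content of the series. [cite: Balaban1985UV3, (43) p.266, (44) p.267] -/
theorem hD_of_threshold (L : ℕ) (hL : 2 ≤ L) {gb ε b₀ p₀ r₀ R₁M₁ B₃ τ : ℝ} (hgb : 0 < gb) (hε : 0 < ε)
    (hb₀ : 0 ≤ b₀) (hp₀ : 0 < p₀) (hr : 0 ≤ r₀) (hRM : 0 ≤ R₁M₁) (hB : 0 ≤ B₃)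
    (g : ℕ → ℝ) (hrun : ∀ i, g i = B10.gRun gb L ε i) {k : ℕ} (hk : 1 ≤ k) (hgk : g k ≤ 1)
    (hτ : Real.sqrt (g (k - 1)) ≤ τ)
    (hsmall : 4 * (L : ℝ) ^ 2 * B₃ * (b₀ * (R₁M₁ * ((r₀ / 4) ^ r₀ * Real.exp (4 - r₀)) *
        ((2 * (p₀ + r₀)) ^ (p₀ + r₀) * Real.exp (1 / 2 - (p₀ + r₀))) + (2 * p₀) ^ p₀ * Real.exp (1 / 2 - p₀))) * τ
      ≤ 1 / 2)
    (D : ℕ → ℕ) (hDle : ∀ j ∈ Finset.Icc 1 k, (D j : ℝ) ≤ R₁M₁ * xlog (g j) ^ r₀ + 1) :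
    ∀ j ∈ Finset.Icc 1 k, (D j : ℝ) * (4 * (L : ℝ) ^ 2 * B₃ * (g (k - 1) * B10.pFun b₀ p₀ (g (k - 1))) *
      ((L : ℝ) ^ j * ((L : ℝ) ^ k)⁻¹) ^ 2) ≤ 1 / 2 := by
  intro j hj
  have hjk : j ≤ k := (Finset.mem_Icc.mp hj).2
  have hLr : (1 : ℝ) < L := by exact_mod_cast lt_of_lt_of_le (by norm_num) hL
  have hLr0 : (0 : ℝ) < L := by linarith
  set s : ℝ := g (k - 1) * B10.pFun b₀ p₀ (g (k - 1)) with hs_def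
  set K : ℝ := (r₀ / 4) ^ r₀ * Real.exp (4 - r₀) with hK_def
  set Q₁ : ℝ := (2 * (p₀ + r₀)) ^ (p₀ + r₀) * Real.exp (1 / 2 - (p₀ + r₀)) with hQ₁_def
  set Q₀ : ℝ := (2 * p₀) ^ p₀ * Real.exp (1 / 2 - p₀) with hQ₀_def
  have hg0 : 0 < g (k - 1) := by rw [hrun]; exact B10.gRun_pos gb L ε hgb hLr0 hε _
  have hg1 : g (k - 1) ≤ 1 := by
    refine le_trans ?_ hgk
    rw [hrun, hrun]; exact gRun_le_of_le gb L ε hgb.le hLr.le hε.le (by omega)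
  have hs0 : 0 ≤ s := mul_nonneg hg0.le (B10.pFun_nonneg b₀ p₀ _ hb₀ hg0 hg1)
  have h4 : 0 ≤ 4 * (L : ℝ) ^ 2 * B₃ := by positivity
  -- (D_j)(L^jη)² ≤ R₁M₁·K·x(g_{k−1})^{r₀} + 1
  have hrad : (D j : ℝ) * ((L : ℝ) ^ j * ((L : ℝ) ^ k)⁻¹) ^ 2 ≤ R₁M₁ * K * xlog (g (k - 1)) ^ r₀ + 1 := by
    have hsc : 0 ≤ ((L : ℝ) ^ j * ((L : ℝ) ^ k)⁻¹) ^ 2 := sq_nonneg _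
    have h1 := mul_le_mul_of_nonneg_right (hDle j hj) hsc
    have h2 := radius_scale_le gb (L : ℝ) ε R₁M₁ r₀ hgb hLr hε hRM hr hjk (by rw [← hrun]; exact hgk)
    rw [← hrun, ← hrun] at h2
    exact h1.trans h2
  -- s·x(g_{k−1})^{r₀} ≤ b₀Q₁√g and s ≤ b₀Q₀√g
  have hsx : s * xlog (g (k - 1)) ^ r₀ ≤ b₀ * Q₁ * Real.sqrt (g (k - 1)) :=
    gpx_le_sqrt b₀ p₀ r₀ (g (k - 1)) hb₀ (by linarith) hg0 hg1
  have hsq : s ≤ b₀ * Q₀ * Real.sqrt (g (k - 1)) := gp_le_sqrt b₀ p₀ (g (k - 1)) hb₀ hp₀ hg0 hg1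
  have hK0 : 0 ≤ R₁M₁ * K := by positivity
  have hQ : 0 ≤ b₀ * (R₁M₁ * K * Q₁ + Q₀) := by positivity
  calc (D j : ℝ) * (4 * (L : ℝ) ^ 2 * B₃ * s * ((L : ℝ) ^ j * ((L : ℝ) ^ k)⁻¹) ^ 2)
      = 4 * (L : ℝ) ^ 2 * B₃ * (((D j : ℝ) * ((L : ℝ) ^ j * ((L : ℝ) ^ k)⁻¹) ^ 2) * s) := by ring
    _ ≤ 4 * (L : ℝ) ^ 2 * B₃ * ((R₁M₁ * K * xlog (g (k - 1)) ^ r₀ + 1) * s) :=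
        mul_le_mul_of_nonneg_left (mul_le_mul_of_nonneg_right hrad hs0) h4
    _ = 4 * (L : ℝ) ^ 2 * B₃ * (R₁M₁ * K * (s * xlog (g (k - 1)) ^ r₀) + s) := by ring
    _ ≤ 4 * (L : ℝ) ^ 2 * B₃ * (R₁M₁ * K * (b₀ * Q₁ * Real.sqrt (g (k - 1))) + b₀ * Q₀ * Real.sqrt (g (k - 1))) := by
        refine mul_le_mul_of_nonneg_left (add_le_add (mul_le_mul_of_nonneg_left hsx hK0) hsq) h4
    _ = 4 * (L : ℝ) ^ 2 * B₃ * (b₀ * (R₁M₁ * K * Q₁ + Q₀)) * Real.sqrt (g (k - 1)) := by ring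
    _ ≤ 4 * (L : ℝ) ^ 2 * B₃ * (b₀ * (R₁M₁ * K * Q₁ + Q₀)) * τ :=
        mul_le_mul_of_nonneg_left hτ (mul_nonneg h4 hQ)
    _ ≤ 1 / 2 := hsmall

end RadiusHD

end Summit.QuantumFields.Balaban3D.Proofs.CouplingWindow

end
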